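import Mathlib

/-!
# The Gaussian ground state of the band-edge (Davies) oscillator (solo-blind kernel #207)

In the momentum representation the frozen streak generator of LEMMA R is `κ d²/dp² + iσ cos p + ε a₀`
(`κ = ε K₀`); at a band edge `cos p ≈ 1 - p²/2` it becomes Davies' complex harmonic oscillator
`κ φ'' - (iσ/2) p² φ = μ φ`.  We verify the ground state algebraically: for `f(z) = exp(-(β/2) z²)` one has
`f'' (z) = (β² z² - β) f(z)`, hence if `κ β² = c` then `κ f'' - c z² f = -κ β f`:  the eigenvalue is `μ₀ = -κ β`
(with `c = iσ/2`, `β = e^{iσπ/4} (2κ)^{-1/2} σ^{1/2}…`, decay rate `Re(κβ) = √(κ)/2` for `|σ| = 1`; SB-C1102 checks this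
against the computed slow pair of the lattice generator).  Stated over `ℂ` (holomorphic version; the real-line statement is its restriction).
-/

namespace Summit.AnomalousDissipation.AnomalousDissipation.Theorems

open Complex

/-- The Gaussian `f(z) = exp(-(β/2) z²)`. -/
noncomputable def daviesGaussian (β : ℂ) (z : ℂ) : ℂ := cexp (-(β / 2) * z ^ 2)

/-- First derivative: `f'(z) = -β z f(z)`. -/
theorem hasDerivAt_daviesGaussian (β z : ℂ) :
    HasDerivAt (daviesGaussian β) (-β * z * daviesGaussian β z) z := by
  have h : HasDerivAt (fun w : ℂ => -(β / 2) * w ^ 2) (-(β / 2) * (2 * z)) z := by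
    simpa using ((hasDerivAt_pow 2 z).const_mul (-(β / 2)))
  have h2 := h.cexp
  unfold daviesGaussian
  exact h2.congr_deriv (by ring)

/-- The derivative function. -/
theorem deriv_daviesGaussian (β : ℂ) :
    deriv (daviesGaussian β) = fun z => -β * z * daviesGaussian β z := by
  funext z; exact (hasDerivAt_daviesGaussian β z).deriv

/-- Second derivative: `f''(z) = (β² z² - β) f(z)`. -/
theorem hasDerivAt_deriv_daviesGaussian (β z : ℂ) :
    HasDerivAt (deriv (daviesGaussian β)) ((β ^ 2 * z ^ 2 - β) * daviesGaussian β z) z := by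
  rw [deriv_daviesGaussian]
  have h1 : HasDerivAt (fun w : ℂ => -β * w) (-β) z := by
    simpa using (hasDerivAt_id z).const_mul (-β)
  have h2 := h1.mul (hasDerivAt_daviesGaussian β z)
  exact h2.congr_deriv (by ring)

/-- The eigen-identity of the complex oscillator: if `κ β² = c` then `κ f'' - c z² f = -κ β f`. -/
theorem davies_ground_state (κ c β z : ℂ) (hβ : κ * β ^ 2 = c) :
    κ * deriv (deriv (daviesGaussian β)) z - c * z ^ 2 * daviesGaussian β z
      = -(κ * β) * daviesGaussian β z := by
  rw [(hasDerivAt_deriv_daviesGaussian β z).deriv, ← hβ]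
  ring

/-- The band-edge parameters: with `c = iσ/2`, `σ² = 1` and `β² = iσ/(2κ)` (`κ ≠ 0`) the hypothesis `κ β² = c` holds,
and the eigenvalue `μ₀ = -κβ` satisfies `μ₀² = κ² β² = iσκ/2` — so `|μ₀|² = κ/2`-sized: decay rate and detuning both `∼ √κ`. -/
theorem davies_band_edge_params (κ σ β : ℂ) (hκ : κ ≠ 0) (hβ : β ^ 2 = I * σ / (2 * κ)) :
    κ * β ^ 2 = I * σ / 2 ∧ (-(κ * β)) ^ 2 = I * σ * κ / 2 := by
  constructor
  · rw [hβ]; field_simp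
  · have : (-(κ * β)) ^ 2 = κ ^ 2 * β ^ 2 := by ring
    rw [this, hβ]; field_simp

end Summit.AnomalousDissipation.AnomalousDissipation.Theorems
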